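import Summits.ValiantsHypothesis.ValiantsHypothesis.Theorems.KPlusLogSqLawTropicalBRefreshExclusivity

/-!
# Route «KPlusLogSqLaw», crux `TropicalB` (stmt-ValiantsHypothesis-19771) — CHANGED-SET EXCLUSIVITY:
# «between consecutive uses of a permutation, a given set of cells is the exact changed set at most `K − 1` times — over ALL permutations»

HONEST FRAMING.  Helper toward the crux `Summit.ValiantsHypothesis.ValiantsHypothesis.Theses.KPlusLogSqLaw.TropicalB` (ledger item
`stmt-ValiantsHypothesis-19771`, registered stubs `stub_tropThin` / `stub_tropFat` of `Cruxes/TropicalB/Lines/birth.lean`; cell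
`pub-symmetroid`, seat val-sym-trop-p4 g4, 2026-08-27; `--supports … --as helper`).  Third file of the REFRESH-EXCLUSIVITY package
(`…TropicalBRefreshExclusivity` = one-column structure part, imported; `…TropicalBHalfThin` = the `R = 1` count).  STRUCTURAL facts about
sign-alternating dominant chains of an ARBITRARY dominance design, with teeth only in the SUPER-FAT corner `K ≫ m` (recycling of
permutations), i.e. OFF the window of the crux; nothing here bears on `TropicalB` in the window, on `WeakLifting` / `Lifting`, on the
cell's real census / DoorA26 / DoorA34, on `MatrixDescartes` (stmt-ValiantsHypothesis-18050) or on VP ≠ VNP.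

CONTENT (the one-column statements of the imported file, for an arbitrary SET `C` of switched columns).
* PIECEWISE EXCHANGE (`compl_sum_lt_of_dominant`): if `P = (σ, λ)` is dominant at `θ`, `Q = (ρ, μ)` at `θ' > θ`, the permutations
  agree on the columns of `C`, and the two terms do not agree off `C`, then the exponent mass OFF `C` is strictly larger at `Q`
  (hybrids: `Q` with `P`'s classes on `C`, `P` with `Q`'s classes on `C`; this is the cyclewise exchange inequality p437800 on the
  invariant column set `Cᶜ`, re-proved import-light).
* ROTATION LEMMA, set form (`no_agreeing_between`): if `σ` is dominant at positions `i < k` with class vectors agreeing off `C`, then no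
  position strictly between carries a permutation `ρ ≠ σ` that agrees with `σ` on `C`.
* ORDERED STEPS (`steps_ordered`): two steps (pairs of consecutive uses of a permutation) `(i,k)`, `(i',k')` with changed columns inside
  `C`, whose permutations agree on `C`, and `k < k'`: at every column `b ∈ C` switched by the later step, the class after the later step
  has STRICTLY larger exponent than the class after the earlier step — whatever the two permutations.  (One column: `refresh_exclusive`.)
* PER-SIGNATURE BOUND (`card_signature_le`): the steps whose changed column set is EXACTLY `C ≠ ∅` and whose permutations agree with a
  fixed row assignment on `C` number at most `K − 1` (their new classes at any `b ∈ C` strictly increase along the chain and differ from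
  the class before the earliest of them).
* CHANGED-SET LAW (`succ_le_card_perms_add`): `n + 1 ≤ |Π| + (K − 1)·ν`, where `Π` is the set of permutations used and `ν` the number of
  distinct CHANGED CELL-SETS (`{(σ b, b) : b switched}`, a nonempty partial permutation matrix) occurring at steps of the chain.  Since a
  cell-set of size `r` can be chosen in `N_r = C(m,r)²·r!` ways, and steps of size `r` cost `r` units of the change mass `≤ m(K−1)|Π|`
  (`sum_card_chg_le` of the `HalfThin` file), one gets for every `R ≥ 1` the law
  `(R+1)(n+1) ≤ (R+1)|Π| + (K−1)·Σ_{r ≤ R} (R+1−r)·N_r + m(K−1)|Π|` (`R = 1` = the landed half-thin law; the arithmetic for `R ≥ 2` is NOT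
  typed here): `R = 2` first helps at `m = 5` (`T(5,K)+1 ≤ 120 + 283.4(K−1)` vs `312.5(K−1)` half-thin vs `600(K−1)+120` thin), and the
  optimal `R ≈ m − e√m` gives `T(m,K) + 1 = O(m!·K)`, a factor `Θ(m)` below the thin law `m!·(m(K−1)+1)`.
Compare `…TropicalBFreshExchanges` (val-sym-trop-p5): there a LABELED exchange (old and new data) never recurs at a chain STEP `k → k+1`;
here an UNLABELED cell-set recurs at most `K − 1` times as the exact changed set between CONSECUTIVE USES of a permutation (other terms in
between), across all permutations containing it.  [this cell; the exchange inequality is folklore]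
-/

-- `Summit.ValiantsHypothesis.ValiantsHypothesis.…` repeats a component by the D-0017 layout
-- (single-conjunct summit), which the `dupNamespace` linter flags; the name is mandated.
set_option linter.dupNamespace false
set_option autoImplicit false

namespace Summit.ValiantsHypothesis.ValiantsHypothesis.Theorems.KPlusLogSqLaw

open Summit.ValiantsHypothesis.ValiantsHypothesis.Theorems.MatrixDescartes.Negative
open Summit.ValiantsHypothesis.ValiantsHypothesis.Theorems.LacunarySymmetroidMatrixDescartes.TropicalCensus
open Finset

namespace RefreshExclusivity

/-! ## 1. Piecewise surgery on a Leibniz term -/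

section Terms

variable {m K : ℕ}

/-- The tropical weight as one sum over columns. [folklore] -/
theorem tropWeight_eq_sum (d : Fin K → ℕ) (v : Fin m → Fin m → Fin K → ℤ) (θ : ℤ)
    (p : Equiv.Perm (Fin m) × (Fin m → Fin K)) :
    tropWeight d v θ p = ∑ b, (θ * (d (p.2 b) : ℤ) - v (p.1 b) b (p.2 b)) := by
  unfold tropWeight
  rw [Finset.mul_sum, ← Finset.sum_sub_distrib]

/-- Tropical weight after replacing the classes on the column set `C` by `f` (same permutation). [folklore] -/
theorem tropWeight_piecewise (d : Fin K → ℕ) (v : Fin m → Fin m → Fin K → ℤ) (θ : ℤ) (C : Finset (Fin m))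
    (f : Fin m → Fin K) (q : Equiv.Perm (Fin m) × (Fin m → Fin K)) :
    tropWeight d v θ (q.1, fun b => if b ∈ C then f b else q.2 b) =
      tropWeight d v θ q + θ * ∑ b ∈ C, ((d (f b) : ℤ) - d (q.2 b)) -
        ∑ b ∈ C, (v (q.1 b) b (f b) - v (q.1 b) b (q.2 b)) := by
  have hpt : ∀ b, (θ * (d (if b ∈ C then f b else q.2 b) : ℤ) - v (q.1 b) b (if b ∈ C then f b else q.2 b)) =
      (θ * (d (q.2 b) : ℤ) - v (q.1 b) b (q.2 b)) +
        (if b ∈ C then (θ * ((d (f b) : ℤ) - d (q.2 b)) - (v (q.1 b) b (f b) - v (q.1 b) b (q.2 b))) else 0) := by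
    intro b
    split_ifs <;> ring
  have hC : ∑ b ∈ C, (θ * ((d (f b) : ℤ) - d (q.2 b)) - (v (q.1 b) b (f b) - v (q.1 b) b (q.2 b))) =
      θ * ∑ b ∈ C, ((d (f b) : ℤ) - d (q.2 b)) - ∑ b ∈ C, (v (q.1 b) b (f b) - v (q.1 b) b (q.2 b)) := by
    rw [Finset.sum_sub_distrib, Finset.mul_sum]
  rw [tropWeight_eq_sum, tropWeight_eq_sum]
  dsimp only
  rw [Finset.sum_congr rfl fun b _ => hpt b, Finset.sum_add_distrib, ← Finset.sum_filter, Finset.filter_mem_eq_inter,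
    Finset.univ_inter, hC]
  ring

/-- A term all of whose incidences are present is present. [folklore] -/
theorem termSign_ne_zero_of_cells {ε : Fin m → Fin m → Fin K → ℤ} (τ : Equiv.Perm (Fin m)) (h : Fin m → Fin K)
    (hall : ∀ b, ε (τ b) b (h b) ≠ 0) : termSign ε (τ, h) ≠ 0 := by
  unfold termSign
  exact mul_ne_zero (Units.ne_zero _) (Finset.prod_ne_zero_iff.mpr fun b _ => hall b)

/-- **Piecewise exchange inequality (cyclewise monotonicity on `Cᶜ`).**  If `p` is dominant at `θ`, `q` at `θ' > θ`, the permutations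
agree on the columns of `C`, and the terms do not agree off `C`, then the exponent mass off `C` is strictly larger at `q`.
[folklore: exchange for parametric assignment] -/
theorem compl_sum_lt_of_dominant (d : Fin K → ℕ) (v ε : Fin m → Fin m → Fin K → ℤ) {θ θ' : ℤ} (hθ : θ < θ')
    {p q : Equiv.Perm (Fin m) × (Fin m → Fin K)} (C : Finset (Fin m)) (hC : ∀ b ∈ C, q.1 b = p.1 b)
    (hdiff : p.1 ≠ q.1 ∨ ∃ b, b ∉ C ∧ p.2 b ≠ q.2 b)
    (hp : IsDominant d v ε θ p) (hq : IsDominant d v ε θ' q) :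
    ∑ b ∈ Cᶜ, (d (p.2 b) : ℤ) < ∑ b ∈ Cᶜ, (d (q.2 b) : ℤ) := by
  have hne1 : (q.1, fun b => if b ∈ C then p.2 b else q.2 b) ≠ p := by
    intro h
    have h1 := congrArg Prod.fst h
    have h2 := congrArg Prod.snd h
    dsimp only at h1 h2
    rcases hdiff with h' | ⟨b, hb, h'⟩
    · exact h' h1.symm
    · have h3 := congrFun h2 b
      rw [if_neg hb] at h3
      exact h' h3.symm
  have hne2 : (p.1, fun b => if b ∈ C then q.2 b else p.2 b) ≠ q := by
    intro h
    have h1 := congrArg Prod.fst h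
    have h2 := congrArg Prod.snd h
    dsimp only at h1 h2
    rcases hdiff with h' | ⟨b, hb, h'⟩
    · exact h' h1
    · have h3 := congrFun h2 b
      rw [if_neg hb] at h3
      exact h' h3
  have hs1 : termSign ε (q.1, fun b => if b ∈ C then p.2 b else q.2 b) ≠ 0 :=
    termSign_ne_zero_of_cells _ _ fun b => by
      by_cases hb : b ∈ C
      · rw [if_pos hb, hC b hb]; exact eps_ne_zero_of_termSign hp.1 b
      · rw [if_neg hb]; exact eps_ne_zero_of_termSign hq.1 b
  have hs2 : termSign ε (p.1, fun b => if b ∈ C then q.2 b else p.2 b) ≠ 0 :=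
    termSign_ne_zero_of_cells _ _ fun b => by
      by_cases hb : b ∈ C
      · rw [if_pos hb, ← hC b hb]; exact eps_ne_zero_of_termSign hq.1 b
      · rw [if_neg hb]; exact eps_ne_zero_of_termSign hp.1 b
  have h1 := hp.2 _ hne1 hs1
  have h2 := hq.2 _ hne2 hs2
  rw [tropWeight_piecewise] at h1 h2
  have hv : ∑ b ∈ C, (v (q.1 b) b (p.2 b) - v (q.1 b) b (q.2 b)) =
      ∑ b ∈ C, (v (p.1 b) b (p.2 b) - v (p.1 b) b (q.2 b)) :=
    Finset.sum_congr rfl fun b hb => by rw [hC b hb]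
  have hd : ∑ b ∈ C, ((d (q.2 b) : ℤ) - d (p.2 b)) = -∑ b ∈ C, ((d (p.2 b) : ℤ) - d (q.2 b)) := by
    rw [← Finset.sum_neg_distrib]
    exact Finset.sum_congr rfl fun _ _ => by ring
  have hv2 : ∑ b ∈ C, (v (p.1 b) b (q.2 b) - v (p.1 b) b (p.2 b)) =
      -∑ b ∈ C, (v (p.1 b) b (p.2 b) - v (p.1 b) b (q.2 b)) := by
    rw [← Finset.sum_neg_distrib]
    exact Finset.sum_congr rfl fun _ _ => by ring
  rw [hv] at h1
  rw [hd, hv2] at h2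
  unfold tropWeight at h1 h2
  rw [← Finset.sum_add_sum_compl C (fun b => (d (p.2 b) : ℤ)),
    ← Finset.sum_add_sum_compl C (fun b => (d (q.2 b) : ℤ))] at h1 h2
  simp only [Finset.sum_sub_distrib] at h1 h2
  by_contra hle
  push Not at hle
  nlinarith [mul_nonneg (sub_nonneg.mpr hθ.le) (sub_nonneg.mpr hle)]

end Terms

/-! ## 2. Chains: the set form of the rotation lemma and ordered steps -/

section Chain

variable {m K n : ℕ} (d : Fin K → ℕ) (v ε : Fin m → Fin m → Fin K → ℤ) (θ : Fin (n + 1) → ℤ)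
  (p : Fin (n + 1) → Equiv.Perm (Fin m) × (Fin m → Fin K))

/-- **ROTATION LEMMA, set form.**  If the permutation of the chain at positions `i < k` is the same `σ` and the two class vectors agree
off the column set `C`, then no position strictly between `i` and `k` carries a permutation different from `σ` that agrees with `σ` on
`C`. [this cell, val-sym-trop-p4 g4] -/
theorem no_agreeing_between (hθ : StrictMono θ) (hdom : ∀ k, IsDominant d v ε (θ k) (p k))
    {i j k : Fin (n + 1)} (hij : i < j) (hjk : j < k) (hik : (p i).1 = (p k).1) (C : Finset (Fin m))
    (hoff : ∀ b, b ∉ C → (p i).2 b = (p k).2 b) (hjC : ∀ b ∈ C, (p j).1 b = (p i).1 b)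
    (hj : (p j).1 ≠ (p i).1) : False := by
  have h1 := compl_sum_lt_of_dominant d v ε (hθ hij) C hjC (Or.inl (Ne.symm hj)) (hdom i) (hdom j)
  have h2 := compl_sum_lt_of_dominant d v ε (hθ hjk) C (fun b hb => by rw [← hik, hjC b hb])
    (Or.inl (by rw [← hik]; exact hj)) (hdom j) (hdom k)
  have h3 : ∑ b ∈ Cᶜ, (d ((p i).2 b) : ℤ) = ∑ b ∈ Cᶜ, (d ((p k).2 b) : ℤ) :=
    Finset.sum_congr rfl fun b hb => by rw [hoff b (Finset.mem_compl.mp hb)]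
  linarith

/-- **ORDERED STEPS (changed-set exclusivity).**  Two steps `(i,k)` and `(i',k')` (consecutive uses of a permutation) with changed columns
inside `C`, whose permutations agree on `C`, and `k < k'`: at every column `b ∈ C` switched by the later step, the exponent after the later
step is strictly larger than after the earlier step.  [this cell, val-sym-trop-p4 g4] -/
theorem steps_ordered (hθ : StrictMono θ) (hdom : ∀ k, IsDominant d v ε (θ k) (p k))
    {i k i' k' : Fin (n + 1)} (C : Finset (Fin m)) {b : Fin m} (hb : b ∈ C)
    (hik : i < k) (hpi : (p i).1 = (p k).1)
    (hik' : i' < k') (hpi' : (p i').1 = (p k').1) (hbtw' : ∀ j, i' < j → j < k' → (p j).1 ≠ (p k').1)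
    (hoff : ∀ b', b' ∉ C → (p i).2 b' = (p k).2 b') (hoff' : ∀ b', b' ∉ C → (p i').2 b' = (p k').2 b')
    (hC : ∀ b' ∈ C, (p k').1 b' = (p k).1 b') (hchg' : (p i').2 b ≠ (p k').2 b) (hlt : k < k') :
    d ((p k).2 b) < d ((p k').2 b) := by
  by_cases hσ : (p k).1 = (p k').1
  · exact d_lt_of_steps_lt d v ε θ p hθ hdom b hik' hpi' hbtw' hσ hlt hchg'
  · have hcell : (p k').1 b = (p k).1 b := hC b hb
    have h2 : i' ≠ k := fun h => hσ (by rw [← h]; exact hpi')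
    have h4 : i' ≠ i := fun h => hσ (by rw [← hpi, ← h]; exact hpi')
    have h3 : ¬ (i < i' ∧ i' < k) := by
      rintro ⟨h5, h6⟩
      exact no_agreeing_between d v ε θ p hθ hdom h5 h6 hpi C hoff
        (fun b' hb' => by rw [hpi', hC b' hb', hpi]) (by rw [hpi', hpi]; exact Ne.symm hσ)
    by_cases h1 : k < i'
    · exact (d_le_of_cell d v ε θ p hθ hdom h1.le b (by rw [hpi', hcell])).trans_lt
        (d_lt_of_cell d v ε θ p hθ hdom hik' b (by rw [hpi']) hchg')
    · have h5 : i' < i := by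
        rcases lt_trichotomy i' i with h | h | h
        · exact h
        · exact absurd h h4
        · exfalso
          rcases lt_trichotomy i' k with h' | h' | h'
          · exact h3 ⟨h, h'⟩
          · exact h2 h'
          · exact h1 h'
      exact (no_agreeing_between d v ε θ p hθ hdom (h5.trans hik) hlt hpi' C hoff'
        (fun b' hb' => by rw [hpi', hC b' hb']) (by rw [hpi']; exact hσ)).elim

/-! ## 3. Counting: per signature, and the changed-set law -/

/-- **PER-SIGNATURE BOUND.**  A family of steps whose changed column set is exactly `C ∋ b` and whose permutations pairwise agree on `C` has
at most `K − 1` members. [this cell, val-sym-trop-p4 g4] -/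
theorem card_signature_le (hθ : StrictMono θ) (hdom : ∀ k, IsDominant d v ε (θ k) (p k))
    (G : Finset (Fin (n + 1) × Fin (n + 1))) (C : Finset (Fin m)) {b : Fin m} (hb : b ∈ C)
    (hG : ∀ ik ∈ G, ik.1 < ik.2 ∧ (p ik.1).1 = (p ik.2).1 ∧ (∀ j, ik.1 < j → j < ik.2 → (p j).1 ≠ (p ik.2).1) ∧
      (∀ b', b' ∉ C → (p ik.1).2 b' = (p ik.2).2 b') ∧ (∀ b' ∈ C, (p ik.1).2 b' ≠ (p ik.2).2 b'))
    (hrows : ∀ ik ∈ G, ∀ ik' ∈ G, ∀ b' ∈ C, (p ik'.2).1 b' = (p ik.2).1 b') :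
    G.card ≤ K - 1 := by
  classical
  rcases G.eq_empty_or_nonempty with h0 | hne
  · rw [h0, Finset.card_empty]
    exact Nat.zero_le _
  obtain ⟨x₀, hx₀, hmin⟩ := G.exists_min_image Prod.snd hne
  obtain ⟨hlt₀, hperm₀, hbtw₀, hoff₀, hchg₀⟩ := hG x₀ hx₀
  -- later endpoints determine steps, and new classes at `b` strictly increase with the later endpoint
  have hord : ∀ x ∈ G, ∀ x' ∈ G, x.2 < x'.2 → d ((p x.2).2 b) < d ((p x'.2).2 b) := by
    intro x hx x' hx' hxx'
    obtain ⟨hltx, hpermx, -, hoffx, -⟩ := hG x hx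
    obtain ⟨hltx', hpermx', hbtwx', hoffx', hchgx'⟩ := hG x' hx'
    exact steps_ordered d v ε θ p hθ hdom C hb hltx hpermx hltx' hpermx' hbtwx' hoffx hoffx'
      (hrows x hx x' hx') (hchgx' b hb) hxx'
  calc G.card ≤ (univ.erase ((p x₀.1).2 b)).card := by
        refine Finset.card_le_card_of_injOn (fun ik => (p ik.2).2 b) (fun x hx => ?_) (fun x hx x' hx' hxx' => ?_)
        · have e0 : d ((p x₀.1).2 b) < d ((p x₀.2).2 b) :=
            d_lt_of_cell d v ε θ p hθ hdom hlt₀ b (by rw [hperm₀]) (hchg₀ b hb)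
          have e1 : d ((p x₀.2).2 b) ≤ d ((p x.2).2 b) := by
            rcases (hmin x hx).eq_or_lt with h | h
            · obtain ⟨hltx, hpermx, hbtwx, -, -⟩ := hG x hx
              have hi : x₀.1 = x.1 :=
                step_fst_unique p (by rw [← h]; exact hlt₀) (by rw [← h]; exact hperm₀) (by rw [← h]; exact hbtw₀)
                  hltx hpermx hbtwx
              have hx0 : x₀ = x := Prod.ext hi h
              rw [hx0]
            · exact (hord x₀ hx₀ x hx h).le
          have hfx : (p x.2).2 b ≠ (p x₀.1).2 b := by
            intro h
            rw [h] at e1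
            exact lt_irrefl _ (e0.trans_le e1)
          exact Finset.mem_coe.mpr (Finset.mem_erase.mpr ⟨hfx, mem_univ _⟩)
        · have hxx : (p x.2).2 b = (p x'.2).2 b := hxx'
          have hk : x.2 = x'.2 := by
            rcases lt_trichotomy x.2 x'.2 with h | h | h
            · have := hord x hx x' hx' h
              rw [hxx] at this
              exact absurd this (lt_irrefl _)
            · exact h
            · have := hord x' hx' x hx h
              rw [hxx] at this
              exact absurd this (lt_irrefl _)
          obtain ⟨hltx, hpermx, hbtwx, -, -⟩ := hG x hx
          obtain ⟨hltx', hpermx', hbtwx', -, -⟩ := hG x' hx'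
          have hi : x.1 = x'.1 :=
            step_fst_unique p hltx hpermx hbtwx (by rw [hk]; exact hltx') (by rw [hk]; exact hpermx')
              (by rw [hk]; exact hbtwx')
          exact Prod.ext hi hk
    _ = K - 1 := by rw [Finset.card_erase_of_mem (mem_univ _), Finset.card_univ, Fintype.card_fin]

/-- **CHANGED-SET LAW.**  For a sign-alternating dominant chain of `n + 1` terms: `n + 1 ≤ |Π| + (K − 1)·ν`, where `Π` is the set of
permutations used and `ν` the number of distinct changed cell-sets `{(σ b, b) : b switched}` occurring at the steps (consecutive uses of a
permutation) of the chain.  (`ν ≤ Σ_{r=1}^{m} C(m,r)²·r!`, the number of nonempty partial permutation matrices; not typed.)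
[this cell, val-sym-trop-p4 g4] -/
theorem succ_le_card_perms_add (hθ : StrictMono θ) (hdom : ∀ k, IsDominant d v ε (θ k) (p k))
    (halt : ∀ k : Fin n, termSign ε (p k.castSucc) * termSign ε (p k.succ) < 0) :
    n + 1 ≤ (univ.image fun k => (p k).1).card + (K - 1) *
      ((univ.filter fun ik : Fin (n + 1) × Fin (n + 1) =>
          ik.1 < ik.2 ∧ (p ik.1).1 = (p ik.2).1 ∧ ∀ j, ik.1 < j → j < ik.2 → (p j).1 ≠ (p ik.2).1).image
        fun ik => (univ.filter fun b => (p ik.1).2 b ≠ (p ik.2).2 b).image fun b => ((p ik.2).1 b, b)).card := by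
  classical
  set St : Finset (Fin (n + 1) × Fin (n + 1)) := univ.filter fun ik =>
      ik.1 < ik.2 ∧ (p ik.1).1 = (p ik.2).1 ∧ ∀ j, ik.1 < j → j < ik.2 → (p j).1 ≠ (p ik.2).1 with hSt
  have hStmem : ∀ ik, ik ∈ St ↔
      ik.1 < ik.2 ∧ (p ik.1).1 = (p ik.2).1 ∧ ∀ j, ik.1 < j → j < ik.2 → (p j).1 ≠ (p ik.2).1 := by
    intro ik
    rw [hSt, Finset.mem_filter]
    exact ⟨fun h => h.2, fun h => ⟨mem_univ _, h⟩⟩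
  set NP : Finset (Fin (n + 1)) := univ.filter fun k => ∀ i, i < k → (p i).1 ≠ (p k).1 with hNP
  have hNPmem : ∀ k, k ∈ NP ↔ ∀ i, i < k → (p i).1 ≠ (p k).1 := by
    intro k
    rw [hNP, Finset.mem_filter]
    exact ⟨fun h => h.2, fun h => ⟨mem_univ _, h⟩⟩
  -- every position is a first use or the later endpoint of a step
  have h1 : ∀ k : Fin (n + 1), k ∈ NP ∨ ∃ i, (i, k) ∈ St := by
    intro k
    by_cases h : ∃ i, i < k ∧ (p i).1 = (p k).1
    · right
      obtain ⟨i₀, hi₀⟩ := h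
      set S : Finset (Fin (n + 1)) := univ.filter fun i => i < k ∧ (p i).1 = (p k).1 with hS
      have hSmem : ∀ i, i ∈ S ↔ i < k ∧ (p i).1 = (p k).1 := by
        intro i
        rw [hS, Finset.mem_filter]
        exact ⟨fun h => h.2, fun h => ⟨mem_univ _, h⟩⟩
      have hSne : S.Nonempty := ⟨i₀, (hSmem i₀).2 hi₀⟩
      obtain ⟨hlt, hperm⟩ := (hSmem _).1 (S.max'_mem hSne)
      refine ⟨S.max' hSne, (hStmem _).2 ⟨hlt, hperm, fun j hj hjk heq => ?_⟩⟩
      exact absurd (S.le_max' j ((hSmem j).2 ⟨hjk, heq⟩)) (not_le.mpr hj)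
    · left
      push Not at h
      exact (hNPmem k).2 h
  have h2 : n + 1 ≤ NP.card + St.card := by
    have hsub : (univ : Finset (Fin (n + 1))) ⊆ NP ∪ St.image Prod.snd := by
      intro k _
      rcases h1 k with h | ⟨i, hi⟩
      · exact Finset.mem_union_left _ h
      · exact Finset.mem_union_right _ (Finset.mem_image.mpr ⟨(i, k), hi, rfl⟩)
    calc n + 1 = (univ : Finset (Fin (n + 1))).card := by rw [Finset.card_univ, Fintype.card_fin]
      _ ≤ (NP ∪ St.image Prod.snd).card := Finset.card_le_card hsub
      _ ≤ NP.card + (St.image Prod.snd).card := Finset.card_union_le _ _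
      _ ≤ NP.card + St.card := Nat.add_le_add_left Finset.card_image_le _
  have h3 : NP.card ≤ (univ.image fun k => (p k).1).card := by
    refine Finset.card_le_card_of_injOn (fun k => (p k).1)
      (fun k _ => Finset.mem_image.mpr ⟨k, mem_univ _, rfl⟩) ?_
    intro k hk k' hk' hkk'
    by_contra hne
    rcases lt_or_gt_of_ne hne with h | h
    · exact (hNPmem k').1 hk' k h hkk'
    · exact (hNPmem k).1 hk k' h (Eq.symm hkk')
  -- the fibres of the signature map have ≤ K − 1 elements
  have h4 : St.card ≤ (K - 1) *
      (St.image fun ik => (univ.filter fun b => (p ik.1).2 b ≠ (p ik.2).2 b).image fun b => ((p ik.2).1 b, b)).card := by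
    refine Finset.card_le_mul_card_image St (K - 1) fun s hs => ?_
    obtain ⟨x₁, hx₁, hsx₁⟩ := Finset.mem_image.mp hs
    obtain ⟨hlt₁, hperm₁, -⟩ := (hStmem x₁).1 hx₁
    -- the changed column set of `x₁`
    set C := univ.filter fun b => (p x₁.1).2 b ≠ (p x₁.2).2 b with hC
    have hCmem : ∀ b, b ∈ C ↔ (p x₁.1).2 b ≠ (p x₁.2).2 b := by
      intro b
      rw [hC, Finset.mem_filter]
      exact ⟨fun h => h.2, fun h => ⟨mem_univ _, h⟩⟩
    have hCne : C.Nonempty := by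
      by_contra h0
      rw [Finset.not_nonempty_iff_eq_empty] at h0
      apply chain_ne d v ε θ p hθ hdom halt hlt₁
      refine Prod.ext hperm₁ (funext fun b => ?_)
      by_contra hbne
      have : b ∈ C := (hCmem b).2 hbne
      rw [h0] at this
      exact absurd this (Finset.notMem_empty b)
    obtain ⟨b, hb⟩ := hCne
    -- unpack «same signature as x₁»
    have hsig : ∀ x ∈ St.filter (fun x => ((univ.filter fun b => (p x.1).2 b ≠ (p x.2).2 b).image
        fun b => ((p x.2).1 b, b)) = s),
        x ∈ St ∧ (∀ b', ((p x.1).2 b' ≠ (p x.2).2 b' ↔ b' ∈ C)) ∧ (∀ b' ∈ C, (p x.2).1 b' = (p x₁.2).1 b') := by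
      intro x hx
      obtain ⟨hxSt, hxs⟩ := Finset.mem_filter.mp hx
      have heq : ((univ.filter fun b => (p x.1).2 b ≠ (p x.2).2 b).image fun b => ((p x.2).1 b, b)) =
          ((univ.filter fun b => (p x₁.1).2 b ≠ (p x₁.2).2 b).image fun b => ((p x₁.2).1 b, b)) := by
        rw [hxs, hsx₁]
      have fwd : ∀ b', (p x.1).2 b' ≠ (p x.2).2 b' → b' ∈ C ∧ (p x.2).1 b' = (p x₁.2).1 b' := by
        intro b' hb'
        have hm : ((p x.2).1 b', b') ∈ (univ.filter fun b => (p x.1).2 b ≠ (p x.2).2 b).image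
            fun b => ((p x.2).1 b, b) :=
          Finset.mem_image.mpr ⟨b', Finset.mem_filter.mpr ⟨mem_univ _, hb'⟩, rfl⟩
        rw [heq] at hm
        obtain ⟨b'', hb'', hpair⟩ := Finset.mem_image.mp hm
        obtain ⟨h1', h2'⟩ := Prod.mk.inj hpair
        subst h2'
        exact ⟨(hCmem _).2 (Finset.mem_filter.mp hb'').2, h1'.symm⟩
      have bwd : ∀ b', b' ∈ C → (p x.1).2 b' ≠ (p x.2).2 b' := by
        intro b' hb'
        have hm : ((p x₁.2).1 b', b') ∈ (univ.filter fun b => (p x₁.1).2 b ≠ (p x₁.2).2 b).image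
            fun b => ((p x₁.2).1 b, b) :=
          Finset.mem_image.mpr ⟨b', Finset.mem_filter.mpr ⟨mem_univ _, (hCmem b').1 hb'⟩, rfl⟩
        rw [← heq] at hm
        obtain ⟨b'', hb'', hpair⟩ := Finset.mem_image.mp hm
        obtain ⟨-, h2'⟩ := Prod.mk.inj hpair
        subst h2'
        exact (Finset.mem_filter.mp hb'').2
      exact ⟨hxSt, fun b' => ⟨fun h => (fwd b' h).1, bwd b'⟩, fun b' hb' => (fwd b' (bwd b' hb')).2⟩
    refine card_signature_le d v ε θ p hθ hdom _ C hb (fun x hx => ?_) (fun x hx x' hx' b' hb' => ?_)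
    · obtain ⟨hxSt, hchg, -⟩ := hsig x hx
      obtain ⟨hltx, hpermx, hbtwx⟩ := (hStmem x).1 hxSt
      refine ⟨hltx, hpermx, hbtwx, fun b' hb' => ?_, fun b' hb' => (hchg b').2 hb'⟩
      by_contra hne
      exact hb' ((hchg b').1 hne)
    · obtain ⟨-, -, hr⟩ := hsig x hx
      obtain ⟨-, -, hr'⟩ := hsig x' hx'
      rw [hr b' hb', hr' b' hb']
  calc n + 1 ≤ NP.card + St.card := h2
    _ ≤ _ := Nat.add_le_add h3 h4

end Chain

end RefreshExclusivity

end Summit.ValiantsHypothesis.ValiantsHypothesis.Theorems.KPlusLogSqLaw
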